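import Summits.KontsevichZagierPeriods.KontsevichZagierPeriods.Theorems.HurwitzMicroSectorsNormalFormPrincipleDimOneAssembly
import Summits.KontsevichZagierPeriods.KontsevichZagierPeriods.Theorems.AbelContractionRealHyperellipticSectorPortCompactify
import Summits.KontsevichZagierPeriods.KontsevichZagierPeriods.Theorems.AbelContractionRealHyperellipticSectorPortBoxRigidityDimOne
import Summits.KontsevichZagierPeriods.KontsevichZagierPeriods.Theorems.AbelContractionRealHyperellipticSectorPortDimOnePiece

/-!
# Route AbelContraction — `RealHyperellipticSector` (crux stmt-KontsevichZagierPeriods-12475):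
# the dimension-certified port, top layer — Kontsevich–Zagier's Conjecture 1 INSIDE dimension one

Helper file of the line `Lines/birth.lean` (stub `stub_bakerAlg`, `--supports` the crux): the port
of `Theorems/HurwitzMicroSectorsNormalFormPrincipleDimOneAssembly.lean` (namespace
`…NormalFormPrinciple.PiBox.Dlog`) INTO THE BUDGET `KZ.relationsLE 1`. Every representation of
KZ's rational shape of dimension `≤ 1` is a mixed normal form in `FormalRep ⧸ relationsLE 1`
(compactify inside the budget — `Port.Kit.exists_sub_sum_bounded_mem_relationsLE` —, cut at the
algebraic break points — `exists_algebraic_breakpoints`, `nfD_of_breakpoints` —, sum), hence: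

* `mem_relationsLE_of_eval_eq_zero_of_dim_le_one` (registered sub-goal) — a formal `ℤ`-combination
  of rational representations of dimensions `≤ 1` with value `0` lies in `relationsLE 1`;
* `kzConjectureLE_of_dim_le_one` — two rational representations of dimensions `≤ 1` with the same
  value are `KZ.EquivalentLE 1` (Conjecture 1 in dimension `≤ 1` with NO excursion to higher
  dimension: the kernel form of `BakerSectorDimOne` of route DimensionBudget);
* `of_mem_relationsLE_of_value_eq_zero_of_dim_le_one`.

Every move of the whole port is a rule-(1a)/(1b)/(2) instance among representations of dimension
`1` or `0`, or a Newton–Leibniz instance `1 → 0`. Input: Baker's theorem (`baker_holds`).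
The dimension-free lemmas (`isRational_restrict`, `exists_algebraic_breakpoints`, the carrier
families) are reused from the originals.

Sources: M. Kontsevich, D. Zagier, *Periods* (2001), §1.2 Conjecture 1 [KontsevichZagier2001];
J. Viu-Sos (2021), Thm. 2.1; A. Baker (1975), Thm. 2.1. No definitions are introduced.
-/

noncomputable section

open MeasureTheory Set
open scoped Polynomial
open Literature.NumberTheory.Transcendental Literature.NumberTheory.Transcendental.KZ
open Literature.ModelTheory.ExponentialFields (IsSemialgebraic)

namespace Summit.KontsevichZagierPeriods.AbelContraction.RealHyperellipticSector.Port

namespace Dlog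

open Summit.KontsevichZagierPeriods.KontsevichZagierPeriods.BetaCancellationNegative
  (volume_setOf_apply_eq_zero)
open Summit.KontsevichZagierPeriods.HurwitzMicroSectors.NormalFormPrinciple.PiBox.Dlog
  (isRational_restrict exists_algebraic_breakpoints exists_carrierA exists_ptCarrierA exists_angCarrier)

variable {RA : ℝ → ℝ → ℝ → IntegralRep 1} {ZA : ℝ → IntegralRep 0} {RG : ℝ → ℝ → IntegralRep 1}

/-- **Finite sums of mixed normal forms are mixed normal forms.** (inside the budget `relationsLE 1`) [cite: KontsevichZagier2001, §1.2 rule (1)] -/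
theorem nfD_sum
    (hZ : ∀ r, IsAlgebraic ℚ r → (ZA r).domain = univ ∧ (ZA r).integrand = fun _ => r)
    {ι : Type*} (s : Finset ι) (f : ι → FormalRep ⧸ relationsLE 1)
    (h : ∀ i ∈ s, ∃ (r : ℝ) (k : ℕ) (u c : Fin k → ℝ) (k' : ℕ) (t d : Fin k' → ℝ), IsAlgebraic ℚ r ∧
      (∀ j, 1 < u j) ∧ (∀ j, IsAlgebraic ℚ (u j)) ∧ (∀ j, IsAlgebraic ℚ (c j)) ∧ (∀ l, 0 ≤ t l) ∧
      (∀ l, IsAlgebraic ℚ (t l)) ∧ (∀ l, IsAlgebraic ℚ (d l)) ∧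
      f i = QuotientAddGroup.mk' (relationsLE 1) (of (ZA r)) +
        ∑ j, QuotientAddGroup.mk' (relationsLE 1) (of (RA 1 (u j) (c j))) +
        ∑ l, QuotientAddGroup.mk' (relationsLE 1) (of (RG (t l) (d l)))) :
    ∃ (r : ℝ) (k : ℕ) (u c : Fin k → ℝ) (k' : ℕ) (t d : Fin k' → ℝ), IsAlgebraic ℚ r ∧ (∀ j, 1 < u j) ∧
      (∀ j, IsAlgebraic ℚ (u j)) ∧ (∀ j, IsAlgebraic ℚ (c j)) ∧ (∀ l, 0 ≤ t l) ∧
      (∀ l, IsAlgebraic ℚ (t l)) ∧ (∀ l, IsAlgebraic ℚ (d l)) ∧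
      ∑ i ∈ s, f i = QuotientAddGroup.mk' (relationsLE 1) (of (ZA r)) +
        ∑ j, QuotientAddGroup.mk' (relationsLE 1) (of (RA 1 (u j) (c j))) +
        ∑ l, QuotientAddGroup.mk' (relationsLE 1) (of (RG (t l) (d l))) := by
  classical
  induction s using Finset.induction_on with
  | empty => rw [Finset.sum_empty]; exact nfD_zero hZ
  | insert a s ha ih =>
    rw [Finset.sum_insert ha]
    exact nfD_add hZ (h a (Finset.mem_insert_self a s)) (ih fun i hi => h i (Finset.mem_insert_of_mem hi))

/-! ## Cutting a bounded rational representation at algebraic break points -/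

/-- **Decomposition at algebraic break points.** Let `N` be a representation of KZ's rational shape
in dimension one whose domain lies in the slab over `(α, β)` (`α, β` real algebraic) and let `F` be a
finite set of real algebraic points of `(α, β)` such that every sub-slab of `(α, β)` avoiding `F` lies
in `N.domain` or is disjoint from it. Then the class of `N` is a mixed normal form: cut at the largest
break point `z` (domain additivity; the cut `{x₀ = z}` is null), treat the right piece — the slab over
`(z, β)` or nothing — by `nfD_of_isRational_interval_any`, and recurse on the left piece inside
`(α, z)`. (inside the budget `relationsLE 1`) [cite: KontsevichZagier2001, §1.2 rules (1), (2)] -/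
theorem nfD_of_breakpoints
    (hR : ∀ a b c, IsAlgebraic ℚ a → IsAlgebraic ℚ b → IsAlgebraic ℚ c → 0 < a →
      (RA a b c).domain = {x | x 0 ∈ Set.Ioo a b} ∧ (RA a b c).integrand = fun x => c / x 0)
    (hZ : ∀ r, IsAlgebraic ℚ r → (ZA r).domain = univ ∧ (ZA r).integrand = fun _ => r)
    (hRG : ∀ t d, IsAlgebraic ℚ t → IsAlgebraic ℚ d →
      (RG t d).domain = {x | x 0 ∈ Set.Ioo 0 t} ∧ (RG t d).integrand = fun x => d / (1 + x 0 ^ 2))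
    (F : Finset ℝ) :
    ∀ (α β : ℝ) (N : IntegralRep 1), IsAlgebraic ℚ α → IsAlgebraic ℚ β →
      (∀ z ∈ F, IsAlgebraic ℚ z) → (∀ z ∈ F, α < z ∧ z < β) →
      N.domain ⊆ {x | x 0 ∈ Set.Ioo α β} →
      (∀ p q : ℝ, α ≤ p → q ≤ β → (∀ z ∈ F, z ∉ Set.Ioo p q) →
        {x : Fin 1 → ℝ | x 0 ∈ Set.Ioo p q} ⊆ N.domain ∨
          Disjoint {x : Fin 1 → ℝ | x 0 ∈ Set.Ioo p q} N.domain) →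
      N.IsRational →
      ∃ (r : ℝ) (k : ℕ) (u c : Fin k → ℝ) (k' : ℕ) (t d : Fin k' → ℝ), IsAlgebraic ℚ r ∧ (∀ j, 1 < u j) ∧
        (∀ j, IsAlgebraic ℚ (u j)) ∧ (∀ j, IsAlgebraic ℚ (c j)) ∧ (∀ l, 0 ≤ t l) ∧
        (∀ l, IsAlgebraic ℚ (t l)) ∧ (∀ l, IsAlgebraic ℚ (d l)) ∧
        QuotientAddGroup.mk' (relationsLE 1) (of N) = QuotientAddGroup.mk' (relationsLE 1) (of (ZA r)) +
          ∑ j, QuotientAddGroup.mk' (relationsLE 1) (of (RA 1 (u j) (c j))) +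
          ∑ l, QuotientAddGroup.mk' (relationsLE 1) (of (RG (t l) (d l))) := by
  classical
  induction F using Finset.induction_on_max with
  | empty =>
    intro α β N hα hβ _ _ hsub hdich hN
    rcases hdich α β le_rfl le_rfl (fun z hz => (Finset.notMem_empty z hz).elim) with h | h
    · exact nfD_of_isRational_interval_any hR hZ hRG hα hβ N (Set.Subset.antisymm hsub h) hN
    · have hNd : N.domain = ∅ :=
        Set.eq_empty_of_forall_notMem fun x hx => Set.disjoint_left.1 h (hsub hx) hx
      have h0 : QuotientAddGroup.mk' (relationsLE 1) (of N) = 0 :=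
        (QuotientAddGroup.eq_zero_iff _).mpr
          (Budget.of_mem_relationsLE_of_volume_eq_zero le_rfl N (by rw [hNd, measure_empty]))
      rw [h0]
      exact nfD_zero hZ
  | insert z F hzmax ih =>
    intro α β N hα hβ halg hin hsub hdich hN
    have hzA : IsAlgebraic ℚ z := halg z (Finset.mem_insert_self z F)
    have hαz : α < z := (hin z (Finset.mem_insert_self z F)).1
    have hzβ : z < β := (hin z (Finset.mem_insert_self z F)).2
    -- the two pieces and the punctured domain
    have hSl : IsSemialgebraic ℚ (N.domain ∩ {x : Fin 1 → ℝ | x 0 < z}) :=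
      N.isSemialgebraic_domain.inter (isSemialgebraic_setOf_apply_lt_const hzA 0)
    have hSr : IsSemialgebraic ℚ (N.domain ∩ {x : Fin 1 → ℝ | z < x 0}) :=
      N.isSemialgebraic_domain.inter (isSemialgebraic_setOf_const_lt_apply hzA 0)
    have hSe : IsSemialgebraic ℚ (N.domain ∩ {x : Fin 1 → ℝ | x 0 = z}ᶜ) :=
      N.isSemialgebraic_domain.inter (isSemialgebraic_setOf_apply_eq_of_isAlgebraic hzA 0).compl
    set Nl := N.restrict _ hSl inter_subset_left with hNl
    set Nr := N.restrict _ hSr inter_subset_left with hNr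
    set Ne := N.restrict _ hSe inter_subset_left with hNe
    -- `[N] ≡ [Ne] ≡ [Nl] + [Nr]`
    have h1 : of N - of Ne ∈ relationsLE 1 := by
      refine Budget.of_sub_of_restrict_mem_relationsLE le_rfl N hSe inter_subset_left ?_
      refine measure_mono_null (fun x hx => ?_) (volume_setOf_apply_eq_zero (0 : Fin 1) z)
      by_contra hxz
      exact hx.2 ⟨hx.1, hxz⟩
    have h2 : of Ne - of Nl - of Nr ∈ relationsLE 1 := by
      refine Budget.domainAdd_mem_relationsLE le_rfl (?_) (?_) (fun _ _ => rfl) fun _ _ => rfl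
      · ext x
        simp only [hNe, hNl, hNr, IntegralRep.domain_restrict, Set.mem_inter_iff, Set.mem_union,
          Set.mem_compl_iff, Set.mem_setOf_eq]
        constructor
        · rintro ⟨hx, hxz⟩
          rcases lt_or_gt_of_ne hxz with h | h
          · exact Or.inl ⟨hx, h⟩
          · exact Or.inr ⟨hx, h⟩
        · rintro (⟨hx, h⟩ | ⟨hx, h⟩)
          · exact ⟨hx, h.ne⟩
          · exact ⟨hx, h.ne'⟩
      · have : Nl.domain ∩ Nr.domain = ∅ := by
          refine Set.eq_empty_of_forall_notMem fun x hx => ?_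
          simp only [hNl, hNr, IntegralRep.domain_restrict, Set.mem_inter_iff, Set.mem_setOf_eq] at hx
          linarith [hx.1.2, hx.2.2]
        rw [this, measure_empty]
    have hcls : QuotientAddGroup.mk' (relationsLE 1) (of N) =
        QuotientAddGroup.mk' (relationsLE 1) (of Nl) + QuotientAddGroup.mk' (relationsLE 1) (of Nr) := by
      have h := (relationsLE 1).add_mem h1 h2
      rw [← QuotientAddGroup.eq_zero_iff] at h
      change QuotientAddGroup.mk' (relationsLE 1) _ = 0 at h
      rw [map_add, map_sub, map_sub, map_sub] at h
      refine sub_eq_zero.mp ?_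
      rw [← h]
      abel
    rw [hcls]
    refine nfD_add hZ ?_ ?_
    · -- the left piece: induction hypothesis inside `(α, z)`
      refine ih α z Nl hα hzA (fun w hw => halg w (Finset.mem_insert_of_mem hw))
        (fun w hw => ⟨(hin w (Finset.mem_insert_of_mem hw)).1, hzmax w hw⟩) ?_ ?_
        (isRational_restrict N hN hSl inter_subset_left)
      · intro x hx
        exact ⟨(hsub hx.1).1, hx.2⟩
      · intro p q hp hq havoid
        have havoid' : ∀ w ∈ insert z F, w ∉ Set.Ioo p q := by
          intro w hw
          rcases Finset.mem_insert.mp hw with rfl | hw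
          · exact fun h => not_lt.mpr hq h.2
          · exact havoid w hw
        rcases hdich p q hp (hq.trans hzβ.le) havoid' with h | h
        · refine Or.inl fun x hx => ⟨h hx, ?_⟩
          exact lt_of_lt_of_le hx.2 hq
        · exact Or.inr (h.mono_right inter_subset_left)
    · -- the right piece: the slab over `(z, β)` or nothing
      have havoid : ∀ w ∈ insert z F, w ∉ Set.Ioo z β := by
        intro w hw
        rcases Finset.mem_insert.mp hw with rfl | hw
        · exact fun h => lt_irrefl _ h.1
        · exact fun h => lt_asymm (hzmax w hw) h.1
      rcases hdich z β hαz.le le_rfl havoid with h | h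
      · have hNrd : Nr.domain = {x | x 0 ∈ Set.Ioo z β} := by
          ext x
          simp only [hNr, IntegralRep.domain_restrict, Set.mem_inter_iff, Set.mem_setOf_eq, Set.mem_Ioo]
          constructor
          · rintro ⟨hx, hzx⟩
            exact ⟨hzx, (hsub hx).2⟩
          · rintro hx
            exact ⟨h hx, hx.1⟩
        exact nfD_of_isRational_interval_any hR hZ hRG hzA hβ Nr hNrd
          (isRational_restrict N hN hSr inter_subset_left)
      · have hNrd : Nr.domain = ∅ := by
          refine Set.eq_empty_of_forall_notMem fun x hx => ?_
          simp only [hNr, IntegralRep.domain_restrict, Set.mem_inter_iff, Set.mem_setOf_eq] at hx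
          exact Set.disjoint_left.1 h (show x ∈ {x : Fin 1 → ℝ | x 0 ∈ Set.Ioo z β} from ⟨hx.2, (hsub hx.1).2⟩) hx.1
        have h0 : QuotientAddGroup.mk' (relationsLE 1) (of Nr) = 0 :=
          (QuotientAddGroup.eq_zero_iff _).mpr
            (Budget.of_mem_relationsLE_of_volume_eq_zero le_rfl Nr (by rw [hNrd, measure_empty]))
        rw [h0]
        exact nfD_zero hZ

/-! ## Every rational representation of dimension `≤ 1` is a mixed normal form -/

/-- **A rational representation of dimension one is a mixed normal form** (any `ℚ`-semialgebraic
domain `σ ⊆ ℝ`): compactify INSIDE the budget (`Port.Kit.exists_sub_sum_bounded_mem_relationsLE`), cut each bounded piece at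
its algebraic break points inside a rational slab `(−M, M)` (`exists_algebraic_breakpoints`,
`nfD_of_breakpoints`), and sum (`nfD_sum`). (inside the budget `relationsLE 1`) [cite: KontsevichZagier2001, §1.2] -/
theorem nfD_of_isRational_dim_one
    (hR : ∀ a b c, IsAlgebraic ℚ a → IsAlgebraic ℚ b → IsAlgebraic ℚ c → 0 < a →
      (RA a b c).domain = {x | x 0 ∈ Set.Ioo a b} ∧ (RA a b c).integrand = fun x => c / x 0)
    (hZ : ∀ r, IsAlgebraic ℚ r → (ZA r).domain = univ ∧ (ZA r).integrand = fun _ => r)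
    (hRG : ∀ t d, IsAlgebraic ℚ t → IsAlgebraic ℚ d →
      (RG t d).domain = {x | x 0 ∈ Set.Ioo 0 t} ∧ (RG t d).integrand = fun x => d / (1 + x 0 ^ 2))
    (N : IntegralRep 1) (hN : N.IsRational) :
    ∃ (r : ℝ) (k : ℕ) (u c : Fin k → ℝ) (k' : ℕ) (t d : Fin k' → ℝ), IsAlgebraic ℚ r ∧ (∀ j, 1 < u j) ∧
      (∀ j, IsAlgebraic ℚ (u j)) ∧ (∀ j, IsAlgebraic ℚ (c j)) ∧ (∀ l, 0 ≤ t l) ∧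
      (∀ l, IsAlgebraic ℚ (t l)) ∧ (∀ l, IsAlgebraic ℚ (d l)) ∧
      QuotientAddGroup.mk' (relationsLE 1) (of N) = QuotientAddGroup.mk' (relationsLE 1) (of (ZA r)) +
        ∑ j, QuotientAddGroup.mk' (relationsLE 1) (of (RA 1 (u j) (c j))) +
        ∑ l, QuotientAddGroup.mk' (relationsLE 1) (of (RG (t l) (d l))) := by
  classical
  obtain ⟨R, hR', hsum⟩ := Kit.exists_sub_sum_bounded_mem_relationsLE le_rfl N hN
  -- each bounded rational piece is a mixed normal form
  have hpiece : ∀ T, ∃ (r : ℝ) (k : ℕ) (u c : Fin k → ℝ) (k' : ℕ) (t d : Fin k' → ℝ), IsAlgebraic ℚ r ∧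
      (∀ j, 1 < u j) ∧ (∀ j, IsAlgebraic ℚ (u j)) ∧ (∀ j, IsAlgebraic ℚ (c j)) ∧ (∀ l, 0 ≤ t l) ∧
      (∀ l, IsAlgebraic ℚ (t l)) ∧ (∀ l, IsAlgebraic ℚ (d l)) ∧
      QuotientAddGroup.mk' (relationsLE 1) (of (R T)) = QuotientAddGroup.mk' (relationsLE 1) (of (ZA r)) +
        ∑ j, QuotientAddGroup.mk' (relationsLE 1) (of (RA 1 (u j) (c j))) +
        ∑ l, QuotientAddGroup.mk' (relationsLE 1) (of (RG (t l) (d l))) := by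
    intro T
    obtain ⟨hTrat, hTbdd⟩ := hR' T
    -- a rational slab containing the bounded domain
    obtain ⟨ρ, hρ⟩ := hTbdd.subset_closedBall 0
    set M : ℝ := (⌈|ρ|⌉₊ : ℝ) + 1 with hM
    have hMA : IsAlgebraic ℚ M := (isAlgebraic_nat _).add isAlgebraic_one
    have hρM : |ρ| < M := by
      have := Nat.le_ceil (|ρ|)
      rw [hM]; linarith
    have hsub : (R T).domain ⊆ {x : Fin 1 → ℝ | x 0 ∈ Set.Ioo (-M) M} := by
      intro x hx
      have h1 : ‖x‖ ≤ ρ := by simpa [dist_zero_right] using hρ hx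
      have h2 : |x 0| ≤ ‖x‖ := by rw [← Real.norm_eq_abs]; exact norm_le_pi_norm x 0
      have h3 : |x 0| < M := lt_of_le_of_lt (h2.trans (h1.trans (le_abs_self ρ))) hρM
      exact ⟨by linarith [neg_abs_le (x 0)], by linarith [le_abs_self (x 0)]⟩
    -- algebraic break points inside `(-M, M)`
    obtain ⟨F₀, hF₀A, hF₀⟩ := exists_algebraic_breakpoints (R T).isSemialgebraic_domain
    set F : Finset ℝ := F₀.filter fun z => -M < z ∧ z < M with hF
    refine nfD_of_breakpoints hR hZ hRG F (-M) M (R T) hMA.neg hMA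
      (fun z hz => hF₀A z (Finset.mem_filter.mp hz).1) (fun z hz => (Finset.mem_filter.mp hz).2)
      hsub (fun p q hp hq havoid => hF₀ p q fun z hz hzpq => ?_) hTrat
    exact havoid z (Finset.mem_filter.mpr ⟨hz, lt_of_le_of_lt hp hzpq.1, lt_of_lt_of_le hzpq.2 hq⟩) hzpq
  -- sum up
  have hcls : QuotientAddGroup.mk' (relationsLE 1) (of N) =
      ∑ T, QuotientAddGroup.mk' (relationsLE 1) (of (R T)) := by
    rw [← QuotientAddGroup.eq_zero_iff] at hsum
    change QuotientAddGroup.mk' (relationsLE 1) _ = 0 at hsum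
    rw [map_sub, map_sum, sub_eq_zero] at hsum
    exact hsum
  rw [hcls]
  exact nfD_sum hZ _ _ fun T _ => hpiece T

/-- **A rational representation of dimension zero is a mixed normal form**: its domain is the point
(a rational point, `nfD_of_isRational_zero`) or empty (the zero class). (inside the budget `relationsLE 1`) [cite: KontsevichZagier2001, §1.2] -/
theorem nfD_of_isRational_dim_zero
    (hZ : ∀ r, IsAlgebraic ℚ r → (ZA r).domain = univ ∧ (ZA r).integrand = fun _ => r)
    (N : IntegralRep 0) (hN : N.IsRational) :
    ∃ (r : ℝ) (k : ℕ) (u c : Fin k → ℝ) (k' : ℕ) (t d : Fin k' → ℝ), IsAlgebraic ℚ r ∧ (∀ j, 1 < u j) ∧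
      (∀ j, IsAlgebraic ℚ (u j)) ∧ (∀ j, IsAlgebraic ℚ (c j)) ∧ (∀ l, 0 ≤ t l) ∧
      (∀ l, IsAlgebraic ℚ (t l)) ∧ (∀ l, IsAlgebraic ℚ (d l)) ∧
      QuotientAddGroup.mk' (relationsLE 1) (of N) = QuotientAddGroup.mk' (relationsLE 1) (of (ZA r)) +
        ∑ j, QuotientAddGroup.mk' (relationsLE 1) (of (RA 1 (u j) (c j))) +
        ∑ l, QuotientAddGroup.mk' (relationsLE 1) (of (RG (t l) (d l))) := by
  rcases Set.eq_empty_or_nonempty N.domain with h | ⟨x₀, hx₀⟩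
  · have h0 : QuotientAddGroup.mk' (relationsLE 1) (of N) = 0 :=
      (QuotientAddGroup.eq_zero_iff _).mpr
        (Budget.of_mem_relationsLE_of_volume_eq_zero zero_le_one N (by rw [h, measure_empty]))
    rw [h0]
    exact nfD_zero hZ
  · refine nfD_of_isRational_zero hZ N ?_ hN
    exact Set.eq_univ_of_forall fun x => by rwa [Subsingleton.elim x x₀]

/-- **Every representation of KZ's rational shape in dimension `≤ 1` is a mixed normal form.**
(inside the budget `relationsLE 1`) [cite: KontsevichZagier2001, §1.2] -/
theorem nfD_of_isRational_dim_le_one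
    (hR : ∀ a b c, IsAlgebraic ℚ a → IsAlgebraic ℚ b → IsAlgebraic ℚ c → 0 < a →
      (RA a b c).domain = {x | x 0 ∈ Set.Ioo a b} ∧ (RA a b c).integrand = fun x => c / x 0)
    (hZ : ∀ r, IsAlgebraic ℚ r → (ZA r).domain = univ ∧ (ZA r).integrand = fun _ => r)
    (hRG : ∀ t d, IsAlgebraic ℚ t → IsAlgebraic ℚ d →
      (RG t d).domain = {x | x 0 ∈ Set.Ioo 0 t} ∧ (RG t d).integrand = fun x => d / (1 + x 0 ^ 2))
    {m : ℕ} (hm : m ≤ 1) (N : IntegralRep m) (hN : N.IsRational) :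
    ∃ (r : ℝ) (k : ℕ) (u c : Fin k → ℝ) (k' : ℕ) (t d : Fin k' → ℝ), IsAlgebraic ℚ r ∧ (∀ j, 1 < u j) ∧
      (∀ j, IsAlgebraic ℚ (u j)) ∧ (∀ j, IsAlgebraic ℚ (c j)) ∧ (∀ l, 0 ≤ t l) ∧
      (∀ l, IsAlgebraic ℚ (t l)) ∧ (∀ l, IsAlgebraic ℚ (d l)) ∧
      QuotientAddGroup.mk' (relationsLE 1) (of N) = QuotientAddGroup.mk' (relationsLE 1) (of (ZA r)) +
        ∑ j, QuotientAddGroup.mk' (relationsLE 1) (of (RA 1 (u j) (c j))) +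
        ∑ l, QuotientAddGroup.mk' (relationsLE 1) (of (RG (t l) (d l))) := by
  obtain rfl | rfl : m = 0 ∨ m = 1 := by omega
  · exact nfD_of_isRational_dim_zero hZ N hN
  · exact nfD_of_isRational_dim_one hR hZ hRG N hN

/-! ## Conjecture 1 in dimension `≤ 1` -/

/-- **Classes of formal combinations of rational representations of dimension `≤ 1` are mixed
normal forms** (closure of `nfD_of_isRational_dim_le_one` under sums and negatives).
(inside the budget `relationsLE 1`) [cite: KontsevichZagier2001, §1.2] -/
theorem nfD_of_mem_closure_dim_le_one
    (hR : ∀ a b c, IsAlgebraic ℚ a → IsAlgebraic ℚ b → IsAlgebraic ℚ c → 0 < a →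
      (RA a b c).domain = {x | x 0 ∈ Set.Ioo a b} ∧ (RA a b c).integrand = fun x => c / x 0)
    (hZ : ∀ r, IsAlgebraic ℚ r → (ZA r).domain = univ ∧ (ZA r).integrand = fun _ => r)
    (hRG : ∀ t d, IsAlgebraic ℚ t → IsAlgebraic ℚ d →
      (RG t d).domain = {x | x 0 ∈ Set.Ioo 0 t} ∧ (RG t d).integrand = fun x => d / (1 + x 0 ^ 2))
    {x : FormalRep}
    (hx : x ∈ AddSubgroup.closure
      {y : FormalRep | ∃ (m : ℕ) (N : IntegralRep m), m ≤ 1 ∧ N.IsRational ∧ y = of N}) :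
    ∃ (r : ℝ) (k : ℕ) (u c : Fin k → ℝ) (k' : ℕ) (t d : Fin k' → ℝ), IsAlgebraic ℚ r ∧ (∀ j, 1 < u j) ∧
      (∀ j, IsAlgebraic ℚ (u j)) ∧ (∀ j, IsAlgebraic ℚ (c j)) ∧ (∀ l, 0 ≤ t l) ∧
      (∀ l, IsAlgebraic ℚ (t l)) ∧ (∀ l, IsAlgebraic ℚ (d l)) ∧
      QuotientAddGroup.mk' (relationsLE 1) x = QuotientAddGroup.mk' (relationsLE 1) (of (ZA r)) +
        ∑ j, QuotientAddGroup.mk' (relationsLE 1) (of (RA 1 (u j) (c j))) +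
        ∑ l, QuotientAddGroup.mk' (relationsLE 1) (of (RG (t l) (d l))) := by
  induction hx using AddSubgroup.closure_induction with
  | mem y hy =>
    obtain ⟨m, N, hm, hN, rfl⟩ := hy
    exact nfD_of_isRational_dim_le_one hR hZ hRG hm N hN
  | zero => rw [map_zero]; exact nfD_zero hZ
  | add y z _ _ ihy ihz => rw [map_add]; exact nfD_add hZ ihy ihz
  | neg y _ ih => rw [map_neg]; exact nfD_neg hR hZ hRG ih

/-- **Conjecture 1 in dimension `≤ 1`, kernel form, INSIDE THE BUDGET** (registered sub-goal of crux
stmt-KontsevichZagierPeriods-12475, port of `PiBox.Dlog.mem_relations_of_eval_eq_zero_of_dim_le_one`).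
A formal `ℤ`-combination of representations of KZ's rational shape of dimensions `≤ 1` whose value
vanishes is a TRUNCATED Kontsevich–Zagier relation of `relationsLE 1`: its
class is a mixed normal form (`nfD_of_mem_closure_dim_le_one`) with value `0`, hence zero by Baker
(`nfD_eq_zero_of_eval_eq_zero`). (inside the budget `relationsLE 1`) [cite: KontsevichZagier2001, §1.2 Conjecture 1] -/
theorem mem_relationsLE_of_eval_eq_zero_of_dim_le_one : ∀ {x : KZ.FormalRep},
    x ∈ AddSubgroup.closure
      {y : KZ.FormalRep | ∃ (m : ℕ) (N : KZ.IntegralRep m), m ≤ 1 ∧ N.IsRational ∧ y = KZ.of N} →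
    KZ.eval x = 0 → x ∈ KZ.relationsLE 1 := by
  intro x hx hv
  classical
  obtain ⟨RA, hR⟩ := exists_carrierA
  obtain ⟨ZA, hZ⟩ := exists_ptCarrierA
  obtain ⟨RG, hRG⟩ := exists_angCarrier
  obtain ⟨r, k, u, c, k', t, d, hr, hu1, hu, hc, ht0, ht, hd, hEq⟩ :=
    nfD_of_mem_closure_dim_le_one hR hZ hRG hx
  exact (QuotientAddGroup.eq_zero_iff _).mp
    (nfD_eq_zero_of_eval_eq_zero hR hZ hRG x hr hu1 hu hc ht0 ht hd hEq hv)

/-- **Kontsevich–Zagier's Conjecture 1 in dimension `≤ 1`.** Two integral representations of KZ's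
rational shape (`IsRational`: integrand `p/q`, `p, q ∈ ℚ[x]`, absolutely integrable over a
`ℚ`-semialgebraic subset of `ℝ`, or a constant over `Fin 0 → ℝ`) of dimensions `n, m ≤ 1` with the
same value are KZ-equivalent BY MOVES AMONG REPRESENTATIONS OF DIMENSION `≤ 1`
(`KZ.EquivalentLE 1`). This is the dimension-`≤ 1` case of the summit `KontsevichZagierPeriods` inside
the budget (the kernel form of `BakerSectorDimOne`, route DimensionBudget), the budget form of item
stmt-KontsevichZagierPeriods-10622; it extends `boxRigidityLE_of_le_one` (the leaf `stub_boxRigidity`,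
domains frozen to unit boxes) to arbitrary domains. Values: `ℚ̄ ∩ (ℚ̄ + Σ ℚ̄ log ℚ̄ + ℚ̄π)`
(`2√2 = ∫_{x²<2} dx`, `log 2 = ∫₁^∞ dx/(x²+x)`, `π = ∫_ℝ dx/(1+x²)`). Input: Baker's theorem
(`baker_holds`). (inside the budget `relationsLE 1`) [cite: KontsevichZagier2001, §1.2 Conjecture 1] -/
theorem kzConjectureLE_of_dim_le_one :
    ∀ ⦃n m : ℕ⦄, n ≤ 1 → m ≤ 1 → ∀ (r : IntegralRep n) (r' : IntegralRep m),
      r.IsRational → r'.IsRational → r.value = r'.value → EquivalentLE 1 r r' := by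
  intro n m hn hm r r' hr hr' hv
  refine mem_relationsLE_of_eval_eq_zero_of_dim_le_one (AddSubgroup.sub_mem _
    (AddSubgroup.subset_closure ⟨n, r, hn, hr, rfl⟩) (AddSubgroup.subset_closure ⟨m, r', hm, hr', rfl⟩)) ?_
  rw [map_sub, eval_of, eval_of, hv, sub_self]

/-- **Conjecture 1 in dimension `≤ 1`, vanishing form**: a rational representation of dimension `≤ 1`
with value `0` is a relation. (inside the budget `relationsLE 1`) [cite: KontsevichZagier2001, §1.2 Conjecture 1] -/
theorem of_mem_relationsLE_of_value_eq_zero_of_dim_le_one {m : ℕ} (hm : m ≤ 1) (N : IntegralRep m)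
    (hN : N.IsRational) (hv : N.value = 0) : of N ∈ relationsLE 1 :=
  mem_relationsLE_of_eval_eq_zero_of_dim_le_one (AddSubgroup.subset_closure ⟨m, N, hm, hN, rfl⟩)
    (by rw [eval_of, hv])

end Dlog


end Summit.KontsevichZagierPeriods.AbelContraction.RealHyperellipticSector.Port

end
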